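import Summits.RiemannHypothesis.RiemannHypothesis.Theorems.GroundBartaPolarPerronFrobeniusGapTransfer
import Summits.RiemannHypothesis.RiemannHypothesis.Theorems.GroundBartaPolarPerronFrobeniusFormDomainBottom
import Summits.RiemannHypothesis.RiemannHypothesis.Theorems.GroundBartaPolarPerronFrobeniusConeFormDomain
import HarnessLib

/-!
# The odd ground state is the near-bottom profile: gap certificate + odd form-domain profile ⇒ `L²` identification,
# and one-signedness on the right half-window up to the certificate budget
(route `RiemannHypothesis/GroundBarta`, crux `PolarPerronFrobenius` = stmt-RiemannHypothesis-18390 and its odd twin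
W-POS-odd = stmt-RiemannHypothesis-17778, helper; RH-free, no definitions, no named facts, no sorry)

Odd twin of `GroundBartaPolarPerronFrobeniusGroundStateProfile` (even sector).  The gap transfer
(`oddTwoLevelProximity_of_gapCertificate`) controls `1 − |⟨v, u⟩|²` for every odd ground state `u` and every SMOOTH odd
window test `v`; the explicit odd Ritz profiles are window functions `𝟙_{[-a,a]} P(x/a)` — odd form-domain vectors, not
tests.  This file closes that gap as on the even side, without sign bookkeeping (the sign of the profile on `(0, a)` is
transported at the end through the `L²` distance):

* `exists_odd_sphere_near` — an odd form-domain profile `w` on `[-a, a]` (`∫|w|² = 1`, finite archimedean energy,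
  `P(w) + 𝓔_a(w) ≤ M_a + B`) is, for every `ε' > 0`, within `ε'` in `L²` of an `L²`-normalised smooth odd window test `v`
  with `Re Q(v) ≤ B + ε'` (interior dilation `weilDilate`, odd mollification `OddSector.exists_odd_mollified_seq`,
  renormalisation; energies by `tendsto_weilDirichletEnergy_weilDilate_window`, `tendsto_weilPoleForm_of_window`);
* `integral_norm_sq_sub_le_of_oddTwoLevelProximity` — the norm form of the odd two-level inequality;
* `oddGroundState_near_profile_of_gapCertificate` — **the odd ground state is the profile**: for an odd-sector ground
  state `u` at `a`, an odd gap certificate `H(φ, m₂)`, a lower bound `L ≤ ε_od(a)` and such a profile `w` with budget `B`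
  (`B + ε' < m₂`): some unit scalar `c` has `∫|c u − w|² ≤ (√(2(B + ε' − L)/(m₂ − (B + ε'))) + √ε')²`
* `setIntegral_negPart_sq_add_im_sq_le` — if the profile is real `≥ 0` on a set `S`, the `L²` distance bounds
  `∫_S ((Re(c u))⁻)² + (Im(c u))²`: one-signedness of the odd ground state on the right half-window up to the budget.
Instantiated at `a = 4023/5000` in `…OddGroundStateProfile8046` (`m₂ = 10⁻⁹`, `B = 1.1·10⁻¹⁴`, `L = 2.1·10⁻¹⁶`).

References: E. Bombieri, Rend. Mat. Acc. Lincei (9) 11 (2000) §4 Thm 3, Thm 5.  Prover B, unit `sr-gb-rung-b` (gen 17).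
-/

set_option linter.dupNamespace false

noncomputable section

open MeasureTheory Complex Filter Set
open scoped Real Topology ComplexConjugate

namespace Summit.RiemannHypothesis.RiemannHypothesis.Theorems.PolarPerronFrobenius

open Literature.NumberTheory.LFunctions
open Literature.NumberTheory.LFunctions.ConnesVanSuijlekom
open Summit.RiemannHypothesis.RiemannHypothesis.Theorems.WeilGroundStateMarkovPart (integral_norm_sq_add_le)
open Summit.RiemannHypothesis.RiemannHypothesis.Theorems.OddSector
  (memLp_weilDilate weilDilate_eq_zero_of_notMem tendsto_weilPoleForm_of_window
    tendsto_integral_norm_sq_of_tendsto_sub exists_odd_mollified_seq twoLevelProximity)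

/-- **Approximating an odd form-domain profile by odd window tests with controlled energy.**  Let `a > 0` and `w ∈ L²`
vanish off `[-a, a]`, odd, with `∫|w|² = 1`, finite archimedean energy and `P(w) + 𝓔_a(w) ≤ M_a + B`.  Then for every
`ε' > 0` there is a window test `v` on `[-a, a]`, odd, with `∫|v|² = 1`, `Re Q(v) ≤ B + ε'` and `∫|v − w|² ≤ ε'`.
[cite: Bombieri2000Weil, §4 proof of Thm 5 (dilation) and Thm 3] -/
theorem exists_odd_sphere_near {a B : ℝ} {w : ℝ → ℂ} (ha : 0 < a) (hw : MemLp w 2)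
    (hws : ∀ x, x ∉ Icc (-a) a → w x = 0) (hwo : ∀ x, w (-x) = -w x)
    (hwN : ∫ x, ‖w x‖ ^ 2 = (1 : ℝ))
    (hwE : IntegrableOn (fun t ↦ weilArchDensity t * weilIncrement w t) (Ioi 0))
    (hle : weilPoleForm w + weilDirichletEnergy a w ≤ weilMarkovConstant a + B) {ε' : ℝ} (hε' : 0 < ε') :
    ∃ v : ℝ → ℂ, IsWeilTest v ∧ tsupport v ⊆ Icc (-a) a ∧ (∀ x, v (-x) = -v x) ∧
      ∫ x, ‖v x‖ ^ 2 = (1 : ℝ) ∧ (weilQuadratic v).re ≤ B + ε' ∧ ∫ x, ‖v x - w x‖ ^ 2 ≤ ε' := by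
  -- adapted from `exists_even_nonneg_sphere_near` (…GroundStateProfile), odd parity, no sign bookkeeping
  set M : ℝ := weilMarkovConstant a with hMdef
  -- (1) interior dilates
  set η : ℕ → ℝ := fun n ↦ 1 / ((n : ℝ) + 1) with hηdef
  have hη0 : ∀ n, 0 ≤ η n := fun n ↦ by positivity
  have hηpos : ∀ n, 0 < η n := fun n ↦ by positivity
  have hη1 : ∀ n, η n ≤ 1 := fun n ↦ by rw [hηdef, div_le_one (by positivity)]; linarith [n.cast_nonneg (α := ℝ)]
  have hηm1 : ∀ n, -1 < η n := fun n ↦ by linarith [hη0 n]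
  have hηlim : Tendsto η atTop (𝓝 0) := tendsto_one_div_add_atTop_nhds_zero_nat
  set f : ℕ → ℝ → ℂ := fun n ↦ weilDilate (η n) w with hfdef
  have hfm : ∀ n, MemLp (f n) 2 := fun n ↦ memLp_weilDilate hw (hηm1 n)
  have hfs : ∀ n x, x ∉ Icc (-(a / (1 + η n))) (a / (1 + η n)) → f n x = 0 := fun n x hx ↦
    weilDilate_eq_zero_of_notMem (hηm1 n) hws hx
  have hba : ∀ n, a / (1 + η n) < a := fun n ↦ by
    rw [div_lt_iff₀ (by linarith [hη0 n])]; nlinarith [hηpos n]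
  have hfs' : ∀ n x, x ∉ Icc (-a) a → f n x = 0 := fun n x hx ↦
    hfs n x fun h ↦ hx ⟨by linarith [h.1, (hba n).le, neg_le_neg (hba n).le], h.2.trans (hba n).le⟩
  have hfo : ∀ n x, f n (-x) = -f n x := fun n x ↦ by
    simp only [hfdef, weilDilate_apply, mul_neg, hwo, mul_neg]
  have hfN : ∀ n, ∫ x, ‖f n x‖ ^ 2 = 1 := fun n ↦ by
    rw [hfdef, integral_norm_sq_weilDilate w (hηm1 n), hwN]
  obtain ⟨hfE, hElim⟩ := tendsto_weilDirichletEnergy_weilDilate_window a ha hw hws hwE hη0 hη1 hηlim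
  have hfL : Tendsto (fun n ↦ ∫ x, ‖f n x - w x‖ ^ 2) atTop (𝓝 0) :=
    tendsto_integral_norm_sq_weilDilate_sub_window hw hws hη0 hη1 hηlim
  have hPlim : Tendsto (fun n ↦ weilPoleForm (f n)) atTop (𝓝 (weilPoleForm w)) :=
    tendsto_weilPoleForm_of_window hw hfm hws hfs' hfL
  -- (2) per dilate, an odd mollified window test within `1/(n+1)` in mass, `L²` and pole form
  have hA : ∀ n, ∃ g : ℝ → ℂ, IsWeilTest g ∧ tsupport g ⊆ Icc (-a) a ∧ (∀ x, g (-x) = -g x) ∧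
      ∫ x, ‖g x - f n x‖ ^ 2 < 1 / ((n : ℝ) + 1) ∧
      |weilPoleForm g - weilPoleForm (f n)| < 1 / ((n : ℝ) + 1) ∧
      |(∫ x, ‖g x‖ ^ 2) - 1| < 1 / ((n : ℝ) + 1) ∧
      weilDirichletEnergy a g ≤ weilDirichletEnergy a (f n) := by
    intro n
    have hδ : (0 : ℝ) < 1 / ((n : ℝ) + 1) := by positivity
    obtain ⟨g, hgt, hgo, hgs, hgD, hgL⟩ := exists_odd_mollified_seq (hfm n) (hfs n) (hfo n)
    have hgm : ∀ k, MemLp (g k) 2 := fun k ↦ (hgt k).memLp_two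
    have hmargin : 0 < a - a / (1 + η n) := by linarith [hba n]
    have hevS : ∀ᶠ k in atTop, tsupport (g k) ⊆ Icc (-a) a := by
      have : ∀ᶠ k : ℕ in atTop, 1 / ((k : ℝ) + 1) < a - a / (1 + η n) :=
        tendsto_one_div_add_atTop_nhds_zero_nat.eventually (eventually_lt_nhds hmargin)
      filter_upwards [this] with k hk
      exact (hgs k).trans (Icc_subset_Icc (by linarith) (by linarith))
    have hgs1 : ∀ k x, x ∉ Icc (-(a + 1)) (a + 1) → g k x = 0 := fun k x hx ↦
      image_eq_zero_of_notMem_tsupport fun h ↦ hx (by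
        have h' := hgs k h
        have hk1 : 1 / ((k : ℝ) + 1) ≤ 1 := by
          rw [div_le_one (by positivity)]; linarith [k.cast_nonneg (α := ℝ)]
        exact ⟨by linarith [h'.1, (hba n).le], by linarith [h'.2, (hba n).le]⟩)
    have hfs1 : ∀ x, x ∉ Icc (-(a + 1)) (a + 1) → f n x = 0 := fun x hx ↦
      hfs' n x fun h ↦ hx ⟨by linarith [h.1], by linarith [h.2]⟩
    have hNlim : Tendsto (fun k ↦ ∫ x, ‖g k x‖ ^ 2) atTop (𝓝 1) := by
      have := tendsto_integral_norm_sq_of_tendsto_sub hgm (hfm n) hgL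
      rwa [hfN n] at this
    have hPg : Tendsto (fun k ↦ weilPoleForm (g k)) atTop (𝓝 (weilPoleForm (f n))) :=
      tendsto_weilPoleForm_of_window (hfm n) hgm hfs1 hgs1 hgL
    have hev1 : ∀ᶠ k in atTop, ∫ x, ‖g k x - f n x‖ ^ 2 < 1 / ((n : ℝ) + 1) :=
      hgL.eventually (eventually_lt_nhds hδ)
    have hev2 : ∀ᶠ k in atTop, |weilPoleForm (g k) - weilPoleForm (f n)| < 1 / ((n : ℝ) + 1) := by
      have := (Metric.tendsto_nhds.1 hPg) _ hδ
      simpa only [Real.dist_eq] using this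
    have hev3 : ∀ᶠ k in atTop, |(∫ x, ‖g k x‖ ^ 2) - 1| < 1 / ((n : ℝ) + 1) := by
      have := (Metric.tendsto_nhds.1 hNlim) _ hδ
      simpa only [Real.dist_eq] using this
    obtain ⟨k, hkS, hk1, hk2, hk3⟩ := (hevS.and (hev1.and (hev2.and hev3))).exists
    exact ⟨g k, hgt k, hkS, hgo k, hk1, hk2, hk3, weilDirichletEnergy_le_of_increment_le (hgD k)
      (integrableOn_weilArchDensity_mul_weilIncrement (hgt k)) (hfE n)⟩
  choose g hgt hgs hgo hgf hgP hgN hgE using hA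
  have hgm : ∀ n, MemLp (g n) 2 := fun n ↦ (hgt n).memLp_two
  have hinv : Tendsto (fun n : ℕ ↦ 1 / ((n : ℝ) + 1)) atTop (𝓝 0) :=
    tendsto_one_div_add_atTop_nhds_zero_nat
  -- (3) masses and renormalisation
  set N : ℕ → ℝ := fun n ↦ ∫ x, ‖g n x‖ ^ 2 with hNdef
  have hN1 : ∀ n, |N n - 1| < 1 / ((n : ℝ) + 1) := hgN
  have hNpos : ∀ n, 0 < N n := fun n ↦ by
    have h1 : 1 / ((n : ℝ) + 1) ≤ 1 := by
      rw [div_le_one (by positivity)]; linarith [n.cast_nonneg (α := ℝ)]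
    have h2 := (abs_lt.1 (hN1 n)).1
    linarith
  have hNlim : Tendsto N atTop (𝓝 1) := by
    have h : Tendsto (fun n ↦ N n - 1) atTop (𝓝 0) :=
      squeeze_zero_norm (fun n ↦ (Real.norm_eq_abs _).trans_le (hN1 n).le) hinv
    simpa using h.add_const 1
  set s : ℕ → ℝ := fun n ↦ Real.sqrt (N n) with hsdef
  have hspos : ∀ n, 0 < s n := fun n ↦ Real.sqrt_pos.2 (hNpos n)
  have hssq : ∀ n, s n ^ 2 = N n := fun n ↦ Real.sq_sqrt (hNpos n).le
  set c : ℕ → ℝ := fun n ↦ (s n)⁻¹ with hcdef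
  have hcpos : ∀ n, 0 < c n := fun n ↦ inv_pos.2 (hspos n)
  have hcsq : ∀ n, c n * c n = (N n)⁻¹ := fun n ↦ by
    rw [hcdef, ← mul_inv, Real.mul_self_sqrt (hNpos n).le]
  set v : ℕ → ℝ → ℂ := fun n t ↦ (c n : ℂ) * g n t with hvdef
  have hvt : ∀ n, IsWeilTest (v n) := fun n ↦ (hgt n).const_mul (c n)
  have hvs : ∀ n, tsupport (v n) ⊆ Icc (-a) a := fun n ↦ tsupport_mul_subset_right.trans (hgs n)
  have hvN : ∀ n, ∫ x, ‖v n x‖ ^ 2 = 1 := fun n ↦ by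
    simp only [hvdef, norm_mul, mul_pow, Complex.norm_real, Real.norm_of_nonneg (hcpos n).le]
    rw [integral_const_mul, show c n ^ 2 = c n * c n by ring, hcsq, inv_mul_cancel₀ (hNpos n).ne']
  have hvm : ∀ n, MemLp (v n) 2 := fun n ↦ (hvt n).memLp_two
  have hvo : ∀ n x, v n (-x) = -v n x := fun n x ↦ by simp only [hvdef, hgo n x, mul_neg]
  -- (4) energies: `Re Q(v n) ≤ (P(f n) + 𝓔_a(f n) + 1/(n+1))/N n − M → P(w) + 𝓔_a(w) − M ≤ B`
  have hQv : ∀ n, (weilQuadratic (v n)).re = (N n)⁻¹ * (weilQuadratic (g n)).re := fun n ↦ by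
    simp only [hvdef]
    rw [weilQuadratic_const_mul, Complex.normSq_ofReal, Complex.re_ofReal_mul, hcsq]
  set U : ℕ → ℝ := fun n ↦
    (weilPoleForm (f n) + weilDirichletEnergy a (f n) + 1 / ((n : ℝ) + 1)) / N n - M with hUdef
  have hup : ∀ n, (weilQuadratic (v n)).re ≤ U n := fun n ↦ by
    have hMarkov := weilQuadratic_re_eq_weilPoleForm_add_weilDirichletEnergy_sub (hgt n) (hgs n)
    have hP := (abs_lt.1 (hgP n)).2
    have hQg : (weilQuadratic (g n)).re ≤
        weilPoleForm (f n) + weilDirichletEnergy a (f n) + 1 / ((n : ℝ) + 1) - M * N n := by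
      rw [hMarkov]; linarith [hgE n]
    rw [hQv n, hUdef]
    have hNi : 0 ≤ (N n)⁻¹ := inv_nonneg.2 (hNpos n).le
    calc (N n)⁻¹ * (weilQuadratic (g n)).re
        ≤ (N n)⁻¹ * (weilPoleForm (f n) + weilDirichletEnergy a (f n) + 1 / ((n : ℝ) + 1) - M * N n) :=
          mul_le_mul_of_nonneg_left hQg hNi
      _ = (weilPoleForm (f n) + weilDirichletEnergy a (f n) + 1 / ((n : ℝ) + 1)) / N n - M := by
          have hN0 : N n ≠ 0 := (hNpos n).ne'
          rw [mul_sub, ← div_eq_inv_mul, show (N n)⁻¹ * (M * N n) = M by field_simp]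
  have hUlim : Tendsto U atTop (𝓝 ((weilPoleForm w + weilDirichletEnergy a w + 0) / 1 - M)) :=
    (((hPlim.add hElim).add hinv).div hNlim one_ne_zero).sub_const M
  rw [add_zero, div_one] at hUlim
  have hLB : weilPoleForm w + weilDirichletEnergy a w - M ≤ B := by linarith
  have hevU : ∀ᶠ n in atTop, U n < B + ε' := hUlim.eventually (eventually_lt_nhds (by linarith))
  -- (5) `v n → w` in `L²`
  have hL : Tendsto (fun n ↦ ∫ x, ‖v n x - w x‖ ^ 2) atTop (𝓝 0) := by
    have hvg : ∀ n, ∫ x, ‖v n x - g n x‖ ^ 2 ≤ (1 / ((n : ℝ) + 1)) ^ 2 := by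
      intro n
      have e : (fun x ↦ ‖v n x - g n x‖ ^ 2) = fun x ↦ (c n - 1) ^ 2 * ‖g n x‖ ^ 2 := by
        funext x
        simp only [hvdef]
        rw [show (c n : ℂ) * g n x - g n x = ((c n - 1 : ℝ) : ℂ) * g n x by push_cast; ring,
          norm_mul, mul_pow, Complex.norm_real, Real.norm_eq_abs, sq_abs]
      rw [e, integral_const_mul]
      have h1 : (c n - 1) ^ 2 * N n = (1 - s n) ^ 2 := by
        have hs0 : s n ≠ 0 := (hspos n).ne'
        have hc : c n = (s n)⁻¹ := rfl
        rw [hc, ← hssq n]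
        field_simp
      have h2 : |1 - s n| ≤ |1 - N n| := by
        rw [← hssq n, show 1 - s n ^ 2 = (1 - s n) * (1 + s n) by ring, abs_mul]
        have : 1 ≤ |1 + s n| := by rw [abs_of_pos (by linarith [hspos n])]; linarith [hspos n]
        nlinarith [abs_nonneg (1 - s n)]
      have h3 : |1 - N n| < 1 / ((n : ℝ) + 1) := by rw [abs_sub_comm]; exact hN1 n
      calc (c n - 1) ^ 2 * N n = |1 - s n| ^ 2 := by rw [h1, sq_abs]
        _ ≤ |1 - N n| ^ 2 := pow_le_pow_left₀ (abs_nonneg _) h2 2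
        _ ≤ (1 / ((n : ℝ) + 1)) ^ 2 := pow_le_pow_left₀ (abs_nonneg _) h3.le 2
    have hbnd : ∀ n, ∫ x, ‖v n x - w x‖ ^ 2 ≤
        2 * (1 / ((n : ℝ) + 1)) ^ 2 + (4 * (1 / ((n : ℝ) + 1)) + 4 * ∫ x, ‖f n x - w x‖ ^ 2) := by
      intro n
      have s1 := integral_norm_sq_add_le ((hvm n).sub (hgm n)) ((hgm n).sub hw)
      have e1 : (fun x ↦ ‖(v n - g n) x + (g n - w) x‖ ^ 2) = fun x ↦ ‖v n x - w x‖ ^ 2 := by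
        funext x; simp only [Pi.sub_apply, sub_add_sub_cancel]
      rw [e1] at s1
      have s2 := integral_norm_sq_add_le ((hgm n).sub (hfm n)) ((hfm n).sub hw)
      have e2 : (fun x ↦ ‖(g n - f n) x + (f n - w) x‖ ^ 2) = fun x ↦ ‖(g n - w) x‖ ^ 2 := by
        funext x; simp only [Pi.sub_apply, sub_add_sub_cancel]
      rw [e2] at s2
      simp only [Pi.sub_apply] at s1 s2 ⊢
      have h3 := hvg n
      have h4 := (hgf n).le
      linarith
    refine squeeze_zero (fun n ↦ integral_nonneg fun _ ↦ by positivity) hbnd ?_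
    have h1 : Tendsto (fun n : ℕ ↦ 2 * (1 / ((n : ℝ) + 1)) ^ 2) atTop (𝓝 (2 * 0 ^ 2)) :=
      (hinv.pow 2).const_mul 2
    have h2 : Tendsto (fun n : ℕ ↦ 4 * (1 / ((n : ℝ) + 1)) + 4 * ∫ x, ‖f n x - w x‖ ^ 2) atTop
        (𝓝 (4 * 0 + 4 * 0)) := (hinv.const_mul 4).add (hfL.const_mul 4)
    simpa using h1.add h2
  have hevL : ∀ᶠ n in atTop, ∫ x, ‖v n x - w x‖ ^ 2 < ε' := hL.eventually (eventually_lt_nhds hε')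
  obtain ⟨n, hnU, hnL⟩ := (hevU.and hevL).exists
  exact ⟨v n, hvt n, hvs n, hvo n, hvN n, ((hup n).trans hnU.le), hnL.le⟩

/-- **Norm form of the odd two-level inequality.**  Under the second-level hypothesis of `OddSector.twoLevelProximity`
(`m₂ ≤ Re Q(h)` for normalised odd window tests `h ⊥ u`, `m₂ > ε_od(a)`), an `L²`-normalised odd window test `v` whose
pairing with the odd ground state `u` is real and `≥ 0` satisfies
`∫|v − u|² ≤ 2 (Re Q(v) − ε_od(a))/(m₂ − ε_od(a))`. [cite: Bombieri2000Weil, §4 Lemma 1 / (4.2), Thm 3] -/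
theorem integral_norm_sq_sub_le_of_oddTwoLevelProximity {a : ℝ} {u : ℝ → ℂ} (hu : IsWeilOddGroundState a u)
    {m₂ : ℝ} (hm : weilOddGroundEnergy a < m₂)
    (H : ∀ h : ℝ → ℂ, IsWeilTest h → tsupport h ⊆ Icc (-a) a → (∀ t, h (-t) = -h t) →
      ∫ t, ‖h t‖ ^ 2 = (1 : ℝ) → ∫ t, h t * conj (u t) = 0 → m₂ ≤ (weilQuadratic h).re)
    {v : ℝ → ℂ} (hv : IsWeilTest v) (hvs : tsupport v ⊆ Icc (-a) a) (hvo : ∀ t, v (-t) = -v t)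
    (hv1 : ∫ t, ‖v t‖ ^ 2 = (1 : ℝ)) (hreal : (∫ t, v t * conj (u t)).im = 0)
    (hpos : 0 ≤ (∫ t, v t * conj (u t)).re) :
    ∫ t, ‖v t - u t‖ ^ 2 ≤ 2 * (((weilQuadratic v).re - weilOddGroundEnergy a) / (m₂ - weilOddGroundEnergy a)) := by
  -- adapted from `integral_norm_sq_sub_le_of_evenTwoLevelProximity` (…EvenOneSignedWindowsTwoLevelProximity)
  have hprox := twoLevelProximity hu hm H hv hvs hvo hv1
  have hum : MemLp u 2 := hu.memLp
  have hvm : MemLp v 2 := isWeilTest_memLp hv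
  have h0 : 0 ≤ ((weilQuadratic v).re - weilOddGroundEnergy a) / (m₂ - weilOddGroundEnergy a) := by
    refine div_nonneg ?_ (sub_pos.2 hm).le
    have := weilOddGroundEnergy_le hv hvs hvo hv1
    linarith
  -- `∫|v − u|² = 2 − 2 Re⟨v, u⟩`
  have h2 := integral_norm_sq_add_mul hvm hum (-1)
  rw [hv1, hu.integral_norm_sq, Complex.normSq_eq_norm_sq] at h2
  have hexp : ∫ t, ‖v t - u t‖ ^ 2 = 2 - 2 * (∫ t, v t * conj (u t)).re := by
    have e : (fun t => ‖v t - u t‖ ^ 2) = fun t => ‖v t + -1 * u t‖ ^ 2 := by funext t; congr 2; ring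
    rw [e, h2]
    simp only [norm_neg, norm_one, one_pow, mul_one, map_neg, map_one, neg_mul, one_mul, Complex.neg_re,
      mul_neg]
    ring
  -- `‖⟨v,u⟩‖ = Re⟨v,u⟩ =: x ≥ 0`
  set P : ℂ := ∫ t, v t * conj (u t) with hP
  have hnorm : ‖P‖ = P.re := by
    have e : P = ((P.re : ℝ) : ℂ) := Complex.ext (by simp) (by simp [hreal])
    rw [e, Complex.norm_real, Real.norm_of_nonneg hpos, Complex.ofReal_re]
  rw [hnorm] at hprox
  rw [hexp]
  rcases le_or_gt P.re 1 with hx1 | hx1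
  · nlinarith [hprox, hpos, hx1]
  · nlinarith [h0, hx1]

/-- `∫|f − h|² ≤ (√∫|f − g|² + √∫|g − h|²)²` for `f, g, h ∈ L²` (copy of `integral_norm_sq_sub_le_sqrt_add_sqrt`, kept
private to this file). [folklore] -/
private theorem ogsp_triangle {f g h : ℝ → ℂ} (hf : MemLp f 2) (hg : MemLp g 2) (hh : MemLp h 2) :
    ∫ x, ‖f x - h x‖ ^ 2 ≤
      (Real.sqrt (∫ x, ‖f x - g x‖ ^ 2) + Real.sqrt (∫ x, ‖g x - h x‖ ^ 2)) ^ 2 := by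
  have hAm : MemLp (fun x ↦ f x - g x) 2 := hf.sub hg
  have hBm : MemLp (fun x ↦ g x - h x) 2 := hg.sub hh
  have hexp := integral_norm_sq_add_mul hAm hBm 1
  have e : (fun x ↦ ‖f x - h x‖ ^ 2) = fun x ↦ ‖(f x - g x) + 1 * (g x - h x)‖ ^ 2 := by
    funext x; congr 2; ring
  rw [e, hexp]
  simp only [map_one, one_mul]
  have hcs : ‖∫ x, (f x - g x) * conj (g x - h x)‖ ≤
      Real.sqrt (∫ x, ‖f x - g x‖ ^ 2) * Real.sqrt (∫ x, ‖g x - h x‖ ^ 2) := by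
    have h0 := norm_integral_mul_conj_sub_le hAm hBm (MemLp.zero' : MemLp (fun _ : ℝ ↦ (0 : ℂ)) 2)
    simpa using h0
  have hre : (∫ x, (f x - g x) * conj (g x - h x)).re ≤
      Real.sqrt (∫ x, ‖f x - g x‖ ^ 2) * Real.sqrt (∫ x, ‖g x - h x‖ ^ 2) :=
    (Complex.re_le_norm _).trans hcs
  have hA0 : 0 ≤ ∫ x, ‖f x - g x‖ ^ 2 := integral_nonneg fun _ ↦ by positivity
  have hB0 : 0 ≤ ∫ x, ‖g x - h x‖ ^ 2 := integral_nonneg fun _ ↦ by positivity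
  nlinarith [Real.sq_sqrt hA0, Real.sq_sqrt hB0, Real.sqrt_nonneg (∫ x, ‖f x - g x‖ ^ 2),
    Real.sqrt_nonneg (∫ x, ‖g x - h x‖ ^ 2)]

/-- **The odd ground state is the near-bottom profile, up to the gap-certificate budget.**  Let `u` be an odd-sector ground
state at `a > 0`, `H(φ, m₂)` an odd gap certificate (`φ ∈ L²`), `L ≤ ε_od(a)` a lower bound, and `w` an odd form-domain
profile on `[-a, a]` with `∫|w|² = 1` and `P(w) + 𝓔_a(w) ≤ M_a + B`.  If `0 < ε'`, `L ≤ B + ε'` and `B + ε' < m₂`, then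
some unit scalar `c` has `∫|c u − w|² ≤ (√(2(B + ε' − L)/(m₂ − (B + ε'))) + √ε')²`.
[cite: Bombieri2000Weil, §4 Thm 3, Thm 5] -/
theorem oddGroundState_near_profile_of_gapCertificate {a B L m₂ ε' : ℝ} {u φ w : ℝ → ℂ} (ha : 0 < a)
    (hu : IsWeilOddGroundState a u) (hφ : MemLp φ 2)
    (H : ∀ k : ℝ → ℂ, IsWeilTest k → tsupport k ⊆ Icc (-a) a → (∀ t, k (-t) = -k t) →
      ∫ t, k t * conj (φ t) = 0 → m₂ * ∫ t, ‖k t‖ ^ 2 ≤ (weilQuadratic k).re)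
    (hL : L ≤ weilOddGroundEnergy a)
    (hw : MemLp w 2) (hws : ∀ x, x ∉ Icc (-a) a → w x = 0) (hwo : ∀ x, w (-x) = -w x)
    (hwN : ∫ x, ‖w x‖ ^ 2 = (1 : ℝ))
    (hwE : IntegrableOn (fun t ↦ weilArchDensity t * weilIncrement w t) (Ioi 0))
    (hle : weilPoleForm w + weilDirichletEnergy a w ≤ weilMarkovConstant a + B)
    (hε' : 0 < ε') (hLB : L ≤ B + ε') (hm : B + ε' < m₂) :
    ∃ c : ℂ, ‖c‖ = 1 ∧
      ∫ t, ‖c * u t - w t‖ ^ 2 ≤ (Real.sqrt (2 * (B + ε' - L) / (m₂ - (B + ε'))) + Real.sqrt ε') ^ 2 := by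
  obtain ⟨v, hv, hvs, hvo, hv1, hQv, hvw⟩ := exists_odd_sphere_near ha hw hws hwo hwN hwE hle hε'
  -- `L ≤ ε_od(a) ≤ Re Q(v) ≤ B + ε' < m₂`
  have hεv : weilOddGroundEnergy a ≤ (weilQuadratic v).re := weilOddGroundEnergy_le hv hvs hvo hv1
  have hεm : weilOddGroundEnergy a < m₂ := by linarith
  -- fix the phase of `u` against `v`
  set p : ℂ := ∫ t, v t * conj (u t) with hp
  obtain ⟨c, hc1, hcp⟩ : ∃ c : ℂ, ‖c‖ = 1 ∧ conj c * p = (‖p‖ : ℂ) := by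
    by_cases hp0 : p = 0
    · exact ⟨1, norm_one, by simp [hp0]⟩
    · refine ⟨p / (‖p‖ : ℂ), ?_, ?_⟩
      · rw [norm_div, Complex.norm_real, Real.norm_of_nonneg (norm_nonneg _),
          div_self (norm_ne_zero_iff.2 hp0)]
      · have hn : (‖p‖ : ℂ) ≠ 0 := Complex.ofReal_ne_zero.2 (norm_ne_zero_iff.2 hp0)
        rw [map_div₀, Complex.conj_ofReal, div_mul_eq_mul_div, div_eq_iff hn, Complex.conj_mul', sq]
  have hcu : IsWeilOddGroundState a (fun t ↦ c * u t) := hu.const_mul hc1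
  have hpair : ∫ t, v t * conj (c * u t) = (‖p‖ : ℂ) := by
    have e : (fun t ↦ v t * conj (c * u t)) = fun t ↦ conj c * (v t * conj (u t)) := by
      funext t; simp only [map_mul]; ring
    rw [e, integral_const_mul, ← hp, hcp]
  have hreal : (∫ t, v t * conj (c * u t)).im = 0 := by rw [hpair, Complex.ofReal_im]
  have hposp : 0 ≤ (∫ t, v t * conj (c * u t)).re := by rw [hpair, Complex.ofReal_re]; exact norm_nonneg _
  have hdist := integral_norm_sq_sub_le_of_oddTwoLevelProximity hcu hεm
    (odd_secondLevel_sphere_of_gapCertificate hcu hεm hφ H) hv hvs hvo hv1 hreal hposp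
  -- the proximity budget
  have hden : 0 < m₂ - weilOddGroundEnergy a := by linarith
  have hden' : 0 < m₂ - (B + ε') := by linarith
  have hbud : 2 * (((weilQuadratic v).re - weilOddGroundEnergy a) / (m₂ - weilOddGroundEnergy a)) ≤
      2 * (B + ε' - L) / (m₂ - (B + ε')) := by
    rw [mul_div_assoc]
    refine mul_le_mul_of_nonneg_left ?_ (by norm_num)
    exact div_le_div₀ (by linarith) (by linarith) hden' (by linarith)
  have h1 : ∫ t, ‖v t - c * u t‖ ^ 2 ≤ 2 * (B + ε' - L) / (m₂ - (B + ε')) := hdist.trans hbud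
  -- triangle inequality: `‖cu − w‖ ≤ ‖cu − v‖ + ‖v − w‖`
  refine ⟨c, hc1, ?_⟩
  have hcum : MemLp (fun t ↦ c * u t) 2 := hcu.memLp
  have htri := ogsp_triangle hcum (isWeilTest_memLp hv) hw
  have hs1 : Real.sqrt (∫ x, ‖c * u x - v x‖ ^ 2) ≤ Real.sqrt (2 * (B + ε' - L) / (m₂ - (B + ε'))) := by
    refine Real.sqrt_le_sqrt ?_
    have e : (fun x ↦ ‖c * u x - v x‖ ^ 2) = fun x ↦ ‖v x - c * u x‖ ^ 2 := by
      funext x; rw [norm_sub_rev]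
    rw [e]; exact h1
  have hs2 : Real.sqrt (∫ x, ‖v x - w x‖ ^ 2) ≤ Real.sqrt ε' := Real.sqrt_le_sqrt hvw
  have hS0 : 0 ≤ Real.sqrt (∫ x, ‖c * u x - v x‖ ^ 2) + Real.sqrt (∫ x, ‖v x - w x‖ ^ 2) :=
    add_nonneg (Real.sqrt_nonneg _) (Real.sqrt_nonneg _)
  exact htri.trans (pow_le_pow_left₀ hS0 (add_le_add hs1 hs2) 2)

/-- Pointwise: `((Re u)⁻)² + (Im u)² ≤ |v − u|²` when `v` is real `≥ 0`. [folklore] -/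
private theorem ogsp_negPart_sq_add_im_sq_le {u v : ℂ} (hv0 : v.im = 0 ∧ 0 ≤ v.re) :
    (max (-u.re) 0) ^ 2 + u.im ^ 2 ≤ ‖v - u‖ ^ 2 := by
  obtain ⟨hvi, hvr⟩ := hv0
  have e : ‖v - u‖ ^ 2 = (v.re - u.re) ^ 2 + u.im ^ 2 := by
    rw [← Complex.normSq_eq_norm_sq, Complex.normSq_apply]
    simp only [Complex.sub_re, Complex.sub_im, hvi, zero_sub]
    ring
  rw [e]
  have hmax : (max (-u.re) 0) ^ 2 ≤ (v.re - u.re) ^ 2 := by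
    rcases le_or_gt 0 u.re with hnn | hneg
    · rw [max_eq_right (neg_nonpos.2 hnn), zero_pow two_ne_zero]
      positivity
    · rw [max_eq_left (neg_nonneg.2 hneg.le)]
      nlinarith
  linarith

/-- **`L²`-closeness to a function that is real `≥ 0` on a set controls the negative and imaginary parts there.**  If
`v` is real and `≥ 0` at every point of a measurable set `S` and `∫|v − u|² ≤ ρ` (`u, v ∈ L²`), then
`∫_S ((Re u)⁻)² + (Im u)² ≤ ρ`. [folklore] -/
theorem setIntegral_negPart_sq_add_im_sq_le {u v : ℝ → ℂ} {ρ : ℝ} {S : Set ℝ} (hS : MeasurableSet S)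
    (hu : MemLp u 2) (hv : MemLp v 2) (hv0 : ∀ t ∈ S, (v t).im = 0 ∧ 0 ≤ (v t).re)
    (h : ∫ t, ‖v t - u t‖ ^ 2 ≤ ρ) :
    ∫ t in S, (max (-(u t).re) 0) ^ 2 + ((u t).im) ^ 2 ≤ ρ := by
  have hint : Integrable (fun t ↦ ‖v t - u t‖ ^ 2) :=
    (memLp_two_iff_integrable_sq_norm (hv.sub hu).1).1 (hv.sub hu)
  have h1 : ∫ t in S, (max (-(u t).re) 0) ^ 2 + ((u t).im) ^ 2 ≤ ∫ t in S, ‖v t - u t‖ ^ 2 := by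
    refine setIntegral_mono_on_ae ?_ hint.integrableOn hS (Eventually.of_forall fun t ht ↦ ?_)
    · -- integrability of the minorant on `S`: it is dominated by the integrable `|v − u|²`
      refine Integrable.mono' hint.integrableOn ?_ (ae_restrict_of_forall_mem hS fun t ht ↦ ?_)
      · have hc : Continuous fun z : ℂ ↦ (max (-z.re) 0) ^ 2 + z.im ^ 2 := by fun_prop
        exact (hc.comp_aestronglyMeasurable hu.1).restrict
      · rw [Real.norm_of_nonneg (add_nonneg (sq_nonneg _) (sq_nonneg _))]
        exact ogsp_negPart_sq_add_im_sq_le (hv0 t ht)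
    · exact ogsp_negPart_sq_add_im_sq_le (hv0 t ht)
  have h2 : ∫ t in S, ‖v t - u t‖ ^ 2 ≤ ∫ t, ‖v t - u t‖ ^ 2 :=
    setIntegral_le_integral hint (Eventually.of_forall fun t ↦ by positivity)
  exact h1.trans (h2.trans h)

end Summit.RiemannHypothesis.RiemannHypothesis.Theorems.PolarPerronFrobenius

end
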